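import Summits.QuantumFields.YangMills.Theorems.BalabanUVNodesN16HolderMSEndSfClass
import Summits.QuantumFields.YangMills.Theorems.BalabanUVNodesN16ConstantOfRecord
import HarnessLib

/-!
# Route «BalabanUVNodes», cluster K4 «SpineRates» — node N16 = NE3: THE END WITH THE MULTI-SCALE (3.40) HÖLDER MEMBER, ITS CONSTANT DISPLAYED AND UNIFORM
# IN `(ε, s₁, b, s₂, β, dom)` (repair R-β″, PRODUCER HALF): generation 3's `N16HolderConst` with the B8 shape `PairLandauGaugeB8AvgMS … s₁ s₂ β dom` and the
# multi-scale β-root `CovRootHolderMS` as conclusion — ONE `(r, C)` for every exponent and every separation range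

Cell `pub-ymgap`, seat `pub-ymgap-dag-n16-c` (R134 fan-out seat, strategy s1; HUMAN RULING D-0062; chair R424 venue), generation 4, file 28 — twin of generation 3's
file 12 `BalabanUVNodesN16HolderConst`; over files 22 (`N16HolderMSDefs`: `CovRootHolderMS`), 25 (`N16HolderMSEnd`: the junction), 26 (`N16HolderMSPairDefs`:
`PairLandauGaugeB8AvgMS`), 27 (`N16HolderMSEndSfClass`) and n16-a's `…N16ConstantOfRecord` (`endConst_le`, `CPLine_pos`).  `--supports stmt-QuantumFields-19912 --as
helper` (K3‴ `SpineGivenEndpointR13`, route rev 16).  `bears_on: R4∕N16 · edge N05 → N16`.  Located item: `HOME/pub-ymgap-dag-n16-c/LOCATED-N16-HOLDER-PIN.md`,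
census row R-β″ (ADDENDUM 5).

WHY.  Same as generation 3's file 12 (N16's CONSTANT OF RECORD re-derived with the Hölder exponent a letter, `β` quantified INSIDE `∃ r … ∃ C`), now with the
third covariant conjunct MULTI-SCALE: the per-pair suppliers of THE END read the `LandauRepB8Avg` part of the B8 shape only, THE END passes the multi-scale member
through (file 25), so `r` and the displayed `C⋆` are unchanged — both are member-free.  Token for token generation 3's file with `PairLandauGaugeB8Avg ↦
PairLandauGaugeB8AvgMS`, `CovRootHolder ↦ CovRootHolderMS`, the junction `N16HolderEnd.… ↦ N16HolderMSEnd.…`.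

WHAT THIS FILE PROVES (kernel, theorems only, 0 `def`, 0 sorry):
§0 `covRootHolderMS_of_pairLandauGaugeB8AvgMS` — file 25's junction concluding BY THE NAME `CovRootHolderMS`.
§1 `covRootHolderMS_sfClass_small_const` — THE END over `sfClass` with the multi-scale member, numeric lines discharged, constant `C⋆` displayed.
§2 `covRootHolderMS_sfClass_small_of_leafH3sup_const` — the sup letter `hF5` traded for N07's `LeafH3sup`, same constant.
§3 `covRootHolderMS_sfClass_small_of_lines_const` — (P♮) by the owner's four k-free lines, `∃ C ≥ 0` right after `∀ g`.
§4 `n16_holderMS_constant_of_record` (`d = 4`): `∃ r > 0, ∀ g > 0, ∃ C ≥ 0, ∀ b′ c′ … ε s₁ b … s₂ β dom, PairLandauGaugeB8AvgMS 4 (sfClass 4 L N ε) L N b g s₁ s₂ β dom →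
   LeafH3sup 4 L N ε b′ c′ dom → CovRootHolderMS 4 (sfClass 4 L N ε) L N b g C s₁ s₂ β dom`; `ne3EnergyRateWCov_of_holderMS_constant_one` (at `β = 1` the record's root).
HONEST FRAMING: binder bookkeeping over LANDED theorems by name (their estimates); the N05 interface `PairLandauGaugeB8AvgMS … β` ([Balaban1985RegularSpaces] Thm 2 +
(1.37) with the (3.40) member multi-scale, at the pair) and the N07 interface `LeafH3sup` ([Balaban1985Variational] Thm 1 (8)+(10)) are HYPOTHESES; nothing of
Bałaban's proved; NE3 ∕ N16 NOT discharged; count-neutral; one finite four-torus at fixed ε — NOT ℝ⁴, NOT infinite volume, NOT OS, NOT a mass gap, NOT Clay.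
-/

set_option autoImplicit false

open scoped BigOperators Matrix Matrix.Norms.L2Operator
open NormedSpace Finset

namespace Summit.QuantumFields.YangMills.BalabanUVNodes.N16HolderMSConst

open Set
open Literature.MathematicalPhysics.QuantumFieldTheory.Balaban1983to89
open B7Prop1Explicit B7Prop2Explicit
open T4AveragingDeficitWall (IsSkewDir IsUnitaryCfg SmallField Ad vary Plane)
open T4AveragingDeficitWallBoundary (IsPeriodicCfg periodBox)
open Summit.QuantumFields.BalabanUV.T4Continuum
open AveragingDeficitPeriodicCounting (IsPeriodicDir)
open AveragingDeficitChartCalculus (cavg)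
open AveragingDeficitMultiLevelPrep (LevelSmall)
open AveragingDeficitTwoLevelPrep (twoLevelSmall)
open MinimalActionSandwich (IsMinimiser)
open MinimalActionRate (Regular sfClass)
open NE3EnergyShapes (residualScale IsUnitarySite IsPeriodicSite)
open NE3EnergyWeightedShapes (energyNormW CurlPairedResidual)
open NE3SlicePoincareShape (SlicePoincare)
open NE3EnergyRateWSupOfSlicePoincare (cLambda cLambda_pos)
open NE3QbarIterCovLiftPrep (cruxC liftC liftC_nonneg)
open NE3RightInverseSolveLetters (thetaLoc cruxC_nonneg)
open NE3RightInverseSupLetters (frameC)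
open NE3ClassRadiusFamily (levelSmall_family)
open NE3EnergyChartLeaves (isUnitaryCfg_cavg_of_regular)
open NE3CurlPairedResidualGaugeQuotient (curlPairedResidual_sfClass_of_tangentProjection)
open NE3ProductPath (pathΓ)
open NE3ProductPathChartSlice (DecomposedRepT)
open NE3SlicePoincareBudgetLine (CPLine ShLine SmallYLine)
open NE3CovariantLineSumsL2 (C2sq)
open NE3CovariantLineSumsL2Tower (rho)
open NE3.PairLandauB8Avg (LandauRepB8Avg PairLandauGaugeB8Avg slicB8)
open NE3.LandauProjectionSupShape (LandauCorrectionSupB8)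
open NE3.SupplierB8SfClassSizes (decomposedRepT_sfClass_of_landauRepB8Avg_towers)
open NE3.TangentProjectionSlicB8Class (tangentProjectionBound_slicB8_sfClass_family)
open NE3.EndLinesNonVacuous (endLines_exists)
open NE3.LeafIndexSockets (LeafH3sup)
open NE3.PairLandauB8EndSupFacts (cruxC_eps_le_half supFacts_const_le)
open NE3.SupRegularityCurvedUniform (one_le_frameC_add)
open NE3.PairLandauB8EndSfClassH3sup (hF5_of_leafH3sup)
open NE3.SlicePoincareCoulombN (CPLine_nonneg)
open NE3.PairLandauB8EndSfClassHP (slicePoincare_slicB8_cavg_of_regular ownerLines_exist)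
open BlockAverageCurrent (curConst curConst_nonneg)
open Summit.QuantumFields.YangMills.BalabanUVNodes.N16HolderMSEnd (covRoot_holderMS_of_pairLandauGaugeB8AvgMS)
open Summit.QuantumFields.YangMills.BalabanUVNodes.N16HolderMSDefs (CovRootHolderMS)
open Summit.QuantumFields.YangMills.BalabanUVNodes.N16HolderMSPairDefs (PairLandauGaugeB8AvgMS)
open Summit.QuantumFields.YangMills.BalabanUVNodes.N16 (endConst_le CPLine_pos)

noncomputable section

variable {d : ℕ} {n : Type*} [Fintype n] [DecidableEq n]

/-! ## §0 Generation 2's junction, concluding by the name `CovRootHolderMS` -/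

/-- **THE END's JUNCTION ON [B8]'s SURFACE AT EXPONENT `β`, NAMED** (class-generic; `d ≥ 1`, `L, N ≥ 1`): `N16HolderEnd.covRoot_holderMS_of_pairLandauGaugeB8AvgMS`
VERBATIM — `PairLandauGaugeB8Avg d 𝒞 L N b g s₁ s₂ β dom` ∧ (per pair, per B8 representative) `DecomposedRepT` on `slicB8` starting at the B8 direction ∧ (P♮)∕(RES♯) on
`slicB8` ∧ the k-free letters ⟹ `CovRootHolderMS d 𝒞 L N b g ((1 + (ν + 23√2·√(16d+1)·(1+ν)))·(4∕cΛ)·C′) s₁ s₂ β dom` (`Λ₁ = s₁`, `Λ₂′ = s₂`).  The inline conclusion of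
the junction is `CovRootHolderMS` unfolded. [folklore] -/
theorem covRootHolderMS_of_pairLandauGaugeB8AvgMS [Nonempty n] (hd : 1 ≤ d) {𝒞 : ℕ → _root_.Set (Site d → Fin d → (Matrix n n ℂ)ˣ)}
    {L N : ℕ} (hL : 1 ≤ L) (hN : 1 ≤ N) {b g s₁ s₂ β : ℝ} {dom : _root_.Set (Site d → Fin d → (Matrix n n ℂ)ˣ)}
    {ν κ₁ κ₂ CP Λ C' : ℝ} (hCP : 0 ≤ CP) (hreg₁ : CP * (Real.sqrt Λ - 1) ^ 2 ≤ 1 / 4) (hν : 0 ≤ ν) (hC' : 0 ≤ C')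
    (hbudget : 2 * Λ * (2 * (1 + 4 * Real.sqrt (16 * d + 1)) * ν) + Λ * (2 * (1 + 4 * Real.sqrt (16 * d + 1)) * ν) ^ 2
        + (2 * κ₁ + 912 * d * κ₂) ≤ cLambda n CP Λ / 2)
    (hB8 : PairLandauGaugeB8AvgMS d 𝒞 L N b g s₁ s₂ β dom)
    (hsupp : ∀ k : ℕ, 1 ≤ k → ∀ V ∈ dom, ∀ UA UB : Site d → Fin d → (Matrix n n ℂ)ˣ,
      IsMinimiser d 𝒞 L N k V UA → IsMinimiser d 𝒞 L N (k + 1) V UB → Regular d L N b g (k + 1) UB →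
      ∀ (u : Site d → (Matrix n n ℂ)ˣ) (Z : Site d → Fin d → Matrix n n ℂ), LandauRepB8Avg L N k (cavg L UB) UA u Z s₁ s₂ β →
        IsUnitaryCfg (cavg L UB) ∧
        ∃ (X Nn : Site d → Fin d → Matrix n n ℂ) (α αN a : ℝ),
          DecomposedRepT 𝒞 L N k V UA UB u X Nn (slicB8 L N k (cavg L UB)) α αN ν κ₁ κ₂ a ∧
          pathΓ X Nn 0 = Z ∧ α ≤ 1 / 40 ∧ αN ≤ 1 / 100 ∧
          (1 + 24 * Real.sqrt d * (Real.exp (10 * (α + αN)) - 1) * (L : ℝ) ^ k) ^ 2 + 48 * d * a * ((L : ℝ) ^ k) ^ 2 ≤ Λ ∧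
          112 * (d : ℝ) * a * CP * ((L : ℝ) ^ k) ^ 2 ≤ 1 / (2 * (Fintype.card n : ℝ)) ∧
          SlicePoincare L k (cavg L UB) (slicB8 L N k (cavg L UB)) CP (periodBox (N * L ^ k)) ∧
          CurlPairedResidual L k (cavg L UB) (slicB8 L N k (cavg L UB)) (C' * residualScale d L N b g k) (periodBox (N * L ^ k))) :
    CovRootHolderMS d 𝒞 L N b g ((1 + (ν + 23 * Real.sqrt 2 * Real.sqrt (16 * d + 1) * (1 + ν))) * (4 / cLambda n CP Λ) * C') s₁ s₂ β dom :=
  covRoot_holderMS_of_pairLandauGaugeB8AvgMS hd hL hN hCP hreg₁ hν hC' hbudget hB8 hsupp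

/-! ## §1 THE END at exponent `β` with its constant displayed, uniform in `(ε, s₁, b, s₂, β, dom)` (slice constant `CP > 0`) -/

/-- **THE END ON B8's SURFACE OVER `sfClass` AT HÖLDER EXPONENT `β`, NUMERIC LINES DISCHARGED, ITS CONSTANT DISPLAYED AND FREE OF `(ε, s₁, b, s₂, β, dom)`** —
`N16.ne3EnergyRateWCov_sfClass_small_const` with `1 ↦ β`: for `3 ≤ d`, `2 ≤ L`, `1 ≤ N`, `CP > 0`, `K₀, K₁ ≥ 0` there is `r > 0` such that for every `g > 0`, all
`0 < ε ≤ r`, `0 ≤ s₁ ≤ r`, `0 ≤ b ≤ ε∕2`, `s₂`, `β`, `dom`: `PairLandauGaugeB8Avg d (sfClass d L N ε) L N b g s₁ s₂ β dom` ∧ per-pair `LandauCorrectionSupB8 (K₀, K₁)` ∧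
per-pair (P♮) on `slicB8` ⟹ `CovRootHolderMS d (sfClass d L N ε) L N b g C⋆ s₁ s₂ β dom`, `C⋆ = C⋆(d, L, card n, CP, g)` the term displayed below (`endLines_exists` +
generation 2's per-pair chain BY NAME + §0 + `endConst_le` + `CovRootHolderMS.mono`). [folklore] -/
theorem covRootHolderMS_sfClass_small_const [Nonempty n] (hd : 3 ≤ d) {L N : ℕ} [NeZero L] [NeZero N] (hL : 2 ≤ L) (hN : 1 ≤ N)
    {CP K₀ K₁ : ℝ} (hCP : 0 < CP) (hK₀ : 0 ≤ K₀) (hK₁ : 0 ≤ K₁) :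
    ∃ r : ℝ, 0 < r ∧ ∀ ⦃g : ℝ⦄, 0 < g → ∀ ⦃ε s₁ b : ℝ⦄, 0 < ε → ε ≤ r → 0 ≤ s₁ → s₁ ≤ r → 0 ≤ b → b ≤ ε / 2 →
      ∀ (s₂ β : ℝ) {dom : _root_.Set (Site d → Fin d → (Matrix n n ℂ)ˣ)},
        PairLandauGaugeB8AvgMS d (sfClass d L N ε) L N b g s₁ s₂ β dom →
        (∀ j : ℕ, ∀ V ∈ dom, ∀ UB : Site d → Fin d → (Matrix n n ℂ)ˣ, IsMinimiser d (sfClass d L N ε) L N (j + 2) V UB → Regular d L N b g (j + 2) UB → ∀ (hWu : IsUnitaryCfg (cavg L UB)) (hx : 0 ≤ ε / ((L : ℝ) ^ (j + 1)) ^ 2) (hs : LevelSmall d L j (ε / ((L : ℝ) ^ (j + 1)) ^ 2)) (hWx : SmallField (cavg L UB) (ε / ((L : ℝ) ^ (j + 1)) ^ 2)) (hθ : cruxC d L * (((L : ℝ) ^ (j + 1)) ^ 2 * (ε / ((L : ℝ) ^ (j + 1)) ^ 2)) < 1), LandauCorrectionSupB8 hL j hWu hx hs hWx N hθ K₀ K₁)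 →
        (∀ j : ℕ, ∀ V ∈ dom, ∀ UB : Site d → Fin d → (Matrix n n ℂ)ˣ, IsMinimiser d (sfClass d L N ε) L N (j + 2) V UB → Regular d L N b g (j + 2) UB → SlicePoincare L (j + 1) (cavg L UB) (slicB8 L N (j + 1) (cavg L UB)) CP (periodBox (N * L ^ (j + 1)))) →
        CovRootHolderMS d (sfClass d L N ε) L N b g
          ((1 + ((1 + 2048 * Real.sqrt (16 * d + 1)) + 23 * Real.sqrt 2 * Real.sqrt (16 * d + 1) * (1 + (1 + 2048 * Real.sqrt (16 * d + 1)))))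
          * (8 * (Fintype.card n : ℝ) * (1 + 4 * CP) * (8 + 1 / (2 * CP)))
          * ((1 + Real.sqrt (192 * ((d : ℝ) * L) * (d + Fintype.card (T4AveragingDeficitWall.Plane d))))
            * (Real.sqrt ((L : ℝ) ^ (d - 2))
              + (Real.sqrt ((L : ℝ) ^ (d - 2)) * Real.sqrt (8 * Fintype.card (T4AveragingDeficitWall.Plane d)) * (128 * (d * (L : ℝ) ^ 2))
                  + 2 * (2048 * ((d : ℝ) + 4) ^ 2 * (L : ℝ) ^ 2 * Real.sqrt (d * (L : ℝ) ^ d))) / 2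
              + (2 * (L : ℝ) ^ (d - 1) + 2 * (8 * d * (L : ℝ) ^ d)) * Real.sqrt (d / (g * (L : ℝ) ^ (d + 2))) / 4)))
          s₁ s₂ β dom := by
  obtain ⟨r, hr0, hr⟩ := endLines_exists (n := n) d L N (le_trans (by norm_num) hL) K₀ K₁ hCP.le
  refine ⟨r, hr0, fun g hg ε s₁ b hε hεr hs₁ hs₁r hb hbh s₂ β dom hB8 hF5 hP => ?_⟩
  obtain ⟨α₀, P, Q, AN, Ac, ah, Λ, hbε, hε1, hbs, hbε', h1, h2, hθε, hθlε, hPsε, hα, hα3, hα4, hεα, hsmall, hc₃, hK, hS1, hP0, hQ0,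
    hPl, hQl, hAN, hAc, hah, hlines₁, hlineJ, hlineN, hlineα, hlineαN, hρ, hlineΛ, hlineCP, hreg₁, hbudget⟩ :=
    hr hε hεr hs₁ hs₁r hb hbh
  have hε0 : 0 ≤ ε := hε.le; have hL1 : 1 ≤ L := le_trans one_le_two hL; have hd1 : 1 ≤ d := le_trans (by norm_num) hd
  -- the letter `ν` of the towers chain (verbatim `…N16HolderEndSfClass` §1)
  have hν : 0 ≤ ((1 + 2048 * Real.sqrt (16 * d + 1)) * (2 * Real.sqrt ((2 * (liftC d / (1 - thetaLoc d L * ε)) ^ 2 + 8 * Fintype.card n * ((d : ℝ) * liftC d ^ 2 * (2 * (d : ℝ) + 8) ^ 2 / (1 - thetaLoc d L * ε) ^ 2)) + (2 * (4 * d * (liftC d * (17 + 16 * (d : ℝ))) ^ 2 / (1 - thetaLoc d L * ε) ^ 2) + 128 * Fintype.card (T4AveragingDeficitWall.Plane d) * Fintype.card n * ((d : ℝ) * liftC d ^ 2 * (2 * (d : ℝ) + 8) ^ 2 / (1 - thetaLoc d L * ε) ^ 2))) * P * s₁)) := by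
    have hlC := liftC_nonneg d
    have h1' : 0 ≤ 1 + 2048 * Real.sqrt (16 * (d : ℝ) + 1) := by positivity
    have h2' : 0 ≤ 2 * Real.sqrt ((2 * (liftC d / (1 - thetaLoc d L * ε)) ^ 2 + 8 * Fintype.card n * ((d : ℝ) * liftC d ^ 2 * (2 * (d : ℝ) + 8) ^ 2 / (1 - thetaLoc d L * ε) ^ 2)) + (2 * (4 * d * (liftC d * (17 + 16 * (d : ℝ))) ^ 2 / (1 - thetaLoc d L * ε) ^ 2) + 128 * Fintype.card (T4AveragingDeficitWall.Plane d) * Fintype.card n * ((d : ℝ) * liftC d ^ 2 * (2 * (d : ℝ) + 8) ^ 2 / (1 - thetaLoc d L * ε) ^ 2))) := by positivity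
    exact mul_nonneg h1' (mul_nonneg (mul_nonneg h2' hP0) hs₁)
  -- the constant of (RES♯) through the gauge quotient
  have hC0 : 0 ≤ Real.sqrt ((L : ℝ) ^ (d - 2))
      + (Real.sqrt ((L : ℝ) ^ (d - 2)) * Real.sqrt (8 * Fintype.card (T4AveragingDeficitWall.Plane d))
          * (128 * (d * (L : ℝ) ^ 2))
        + 2 * (2048 * ((d : ℝ) + 4) ^ 2 * (L : ℝ) ^ 2 * Real.sqrt (d * (L : ℝ) ^ d))) * b
      + b ^ 2 * (2 * (L : ℝ) ^ (d - 1) + 2 * (8 * d * (L : ℝ) ^ d)) * Real.sqrt (d / (g * (L : ℝ) ^ (d + 2))) := by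
    positivity
  have hK25 : 0 ≤ 1 + Real.sqrt (192 * ((d : ℝ) * L) * (d + Fintype.card (T4AveragingDeficitWall.Plane d))) := by positivity
  have hC' := mul_nonneg hK25 hC0
  have hsmallLv : ∀ j : ℕ, LevelSmall d L (j + 1) (ε / ((L : ℝ) ^ (j + 2)) ^ 2) := levelSmall_family hL hε0 h1 h2
  have hb2 : b ≤ 1 / 2 := by linarith
  refine (covRootHolderMS_of_pairLandauGaugeB8AvgMS hd1 hL1 hN hCP.le hreg₁ hν hC' hbudget hB8 ?_).mono
    (endConst_le (n := n) ?_ ?_ ?_ hP0 hs₁ hCP ?_ ?_ ?_ ?_ ?_ hb hb2 hρ hreg₁) le_rfl le_rfl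
  · intro k hk V hV UA UB hA hB hreg u Z hZ
    obtain ⟨j, rfl⟩ : ∃ j, k = j + 1 := ⟨k - 1, by omega⟩
    have hW : IsUnitaryCfg (cavg L UB) := isUnitaryCfg_cavg_of_regular hL1 j hb hbε (hsmallLv j) hreg
    obtain ⟨X, Nn, α, αN, a, hdec, hΓ0, hα40, hαN100, hJ1, hJ2⟩ :=
      decomposedRepT_sfClass_of_landauRepB8Avg_towers hd hL hN hb hε0 hε1 hbs hbε' h1 h2 hθε hθlε hPsε hα hα3 hα4 hεα hs₁ hsmall hc₃ hK hS1 hP0 hQ0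
        hPl hQl hK₀ hK₁ hCP.le hAN hAc hah hlines₁ hlineJ hlineN hlineα hlineαN hρ hlineΛ hlineCP j hA hB hreg hZ (hF5 j V hV UB hB hreg)
    have hproj := tangentProjectionBound_slicB8_sfClass_family hd hL hN hb hε0 hε1 hbs hbε' h1 h2 j hreg
    have hres := curlPairedResidual_sfClass_of_tangentProjection (le_trans (by norm_num) hd) hL1 hN j hb hbε hg (hsmallLv j) hB hreg hproj
    rw [← mul_assoc] at hres
    exact ⟨hW, X, Nn, α, αN, a, hdec, hΓ0, hα40, hαN100, hJ1, hJ2, hP j V hV UB hB hreg, hres⟩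
  all_goals positivity

/-! ## §2 `hF5` traded for N07's interface (H3ˢᵘᵖ) — the constant threaded, at exponent `β` -/

/-- **THE END AT EXPONENT `β` WITH THE SUP LETTER GONE, SAME DISPLAYED CONSTANT** — `N16.ne3EnergyRateWCov_sfClass_small_of_leafH3sup_const` with `1 ↦ β` (same
proof: the uniform majorants `K₀*`, `K₁*` are closed terms in `(d, L, N, card n)` and do not enter the constant): `∃ r > 0, ∀ g > 0, ∀` leaf letters `0 ≤ b′, c′` on
(Rb) and the `c′`-line, `∀ 0 < ε ≤ r, 0 ≤ s₁ ≤ r, 0 ≤ b ≤ ε∕2, ∀ s₂ β dom`: `PairLandauGaugeB8Avg d (sfClass d L N ε) L N b g s₁ s₂ β dom` ∧ `LeafH3sup d L N ε b′ c′ dom`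
∧ per-pair (P♮) on `slicB8` with constant `CP > 0` ⟹ `CovRootHolderMS d (sfClass d L N ε) L N b g C⋆ s₁ s₂ β dom`. [folklore] -/
theorem covRootHolderMS_sfClass_small_of_leafH3sup_const [Nonempty n] (hd : 3 ≤ d) {L N : ℕ} [NeZero L] [NeZero N] (hL : 2 ≤ L)
    (hN : 1 ≤ N) {CP : ℝ} (hCP : 0 < CP) :
    ∃ r : ℝ, 0 < r ∧ ∀ ⦃g : ℝ⦄, 0 < g → ∀ ⦃b' c' : ℝ⦄, 0 ≤ b' → 0 ≤ c' →
      2 ^ 15 * ((d : ℝ) + 1) ^ 2 * ((d : ℝ) + 4) ^ 2 * (L : ℝ) ^ 2 * b' ≤ 1 →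
      23040 * (d : ℝ) ^ 4 * (frameC d L + d) ^ 3 * (c' + curConst d L * b' ^ 2) ≤ 1 → ∀ ⦃ε s₁ b : ℝ⦄, 0 < ε → ε ≤ r → 0 ≤ s₁ → s₁ ≤ r → 0 ≤ b → b ≤ ε / 2 →
      ∀ (s₂ β : ℝ) {dom : _root_.Set (Site d → Fin d → (Matrix n n ℂ)ˣ)},
        PairLandauGaugeB8AvgMS d (sfClass d L N ε) L N b g s₁ s₂ β dom →
        LeafH3sup d L N ε b' c' dom →
        (∀ j : ℕ, ∀ V ∈ dom, ∀ UB : Site d → Fin d → (Matrix n n ℂ)ˣ, IsMinimiser d (sfClass d L N ε) L N (j + 2) V UB → Regular d L N b g (j + 2) UB →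
          SlicePoincare L (j + 1) (cavg L UB) (slicB8 L N (j + 1) (cavg L UB)) CP (periodBox (N * L ^ (j + 1)))) →
        CovRootHolderMS d (sfClass d L N ε) L N b g
          ((1 + ((1 + 2048 * Real.sqrt (16 * d + 1)) + 23 * Real.sqrt 2 * Real.sqrt (16 * d + 1) * (1 + (1 + 2048 * Real.sqrt (16 * d + 1)))))
          * (8 * (Fintype.card n : ℝ) * (1 + 4 * CP) * (8 + 1 / (2 * CP)))
          * ((1 + Real.sqrt (192 * ((d : ℝ) * L) * (d + Fintype.card (T4AveragingDeficitWall.Plane d))))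
            * (Real.sqrt ((L : ℝ) ^ (d - 2))
              + (Real.sqrt ((L : ℝ) ^ (d - 2)) * Real.sqrt (8 * Fintype.card (T4AveragingDeficitWall.Plane d)) * (128 * (d * (L : ℝ) ^ 2))
                  + 2 * (2048 * ((d : ℝ) + 4) ^ 2 * (L : ℝ) ^ 2 * Real.sqrt (d * (L : ℝ) ^ d))) / 2
              + (2 * (L : ℝ) ^ (d - 1) + 2 * (8 * d * (L : ℝ) ^ d)) * Real.sqrt (d / (g * (L : ℝ) ^ (d + 2))) / 4)))
          s₁ s₂ β dom := by
  have hd1 : 1 ≤ d := le_trans (by norm_num) hd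
  -- the level-free constant and the uniform majorants `K₀*`, `K₁*` of `K₀(ε)`, `K₁(ε)` (verbatim `…N16ConstantOfRecord` §3)
  obtain ⟨cR, hcR⟩ : ∃ K : ℝ, K = 1 + 2 * (Fintype.card n : ℝ) * (64 * (d : ℝ) ^ 2 * N) ^ d + 27 * (Fintype.card n : ℝ) ^ 3 * (512 : ℝ) ^ d * (N : ℝ) ^ d := ⟨_, rfl⟩
  have hcR0 : 0 ≤ cR := by rw [hcR]; positivity
  have hF0 : 0 ≤ frameC d L + d := le_trans zero_le_one (one_le_frameC_add hd1 L)
  obtain ⟨K₀s, hK₀s⟩ : ∃ K : ℝ, K = 2 * ((d : ℝ) * liftC d * (36 * d * (frameC d L + d) ^ 2) * cR * (6 + 2 * ((d : ℝ) + 1))) := ⟨_, rfl⟩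
  obtain ⟨K₁s, hK₁s⟩ : ∃ K : ℝ, K = 2 * ((d : ℝ) * liftC d * (36 * d * (frameC d L + d)) * cR * (6 + 2 * ((d : ℝ) + 1))) := ⟨_, rfl⟩
  have hK₀ : 0 ≤ K₀s := by rw [hK₀s]; have := liftC_nonneg d; positivity
  have hK₁ : 0 ≤ K₁s := by rw [hK₁s]; have := liftC_nonneg d; positivity
  obtain ⟨r, hr0, hr⟩ := covRootHolderMS_sfClass_small_const (n := n) hd hL hN (CP := CP) hCP hK₀ hK₁
  have hc := cruxC_nonneg d L
  have hρ0 : 0 < 1 / (2 * cruxC d L + 2) := by positivity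
  have hd0 : (0 : ℝ) < d := by exact_mod_cast hd1
  have hF1 : (1 : ℝ) ≤ frameC d L + d := one_le_frameC_add hd1 L
  have hF2 : 0 < 23040 * (d : ℝ) ^ 4 * (frameC d L + d) ^ 2 := by positivity
  have hσ0 : 0 < 1 / (23040 * (d : ℝ) ^ 4 * (frameC d L + d) ^ 2) := by positivity
  refine ⟨min r (min (1 / (2 * cruxC d L + 2)) (1 / (23040 * (d : ℝ) ^ 4 * (frameC d L + d) ^ 2))), lt_min hr0 (lt_min hρ0 hσ0),
    fun g hg b' c' hb' hc' hRb hcF ε s₁ b hε hεr hs₁ hs₁r hb hbh s₂ β dom hB8 h3 hP => ?_⟩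
  have hεr' : ε ≤ r := hεr.trans (min_le_left _ _); have hs₁r' : s₁ ≤ r := hs₁r.trans (min_le_left _ _)
  obtain ⟨hcε, hε1⟩ := cruxC_eps_le_half d L hε.le (hεr.trans ((min_le_right _ _).trans (min_le_left _ _)))
  have hεF : 23040 * (d : ℝ) ^ 4 * (frameC d L + d) ^ 2 * ε ≤ 1 := by
    have h1 : ε ≤ 1 / (23040 * (d : ℝ) ^ 4 * (frameC d L + d) ^ 2) := hεr.trans ((min_le_right _ _).trans (min_le_right _ _))
    rw [le_div_iff₀ hF2] at h1; linarith
  -- `K(ε) ≤ K*`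
  have hle₀ : (d : ℝ) * liftC d * (6 + 2 * ((d : ℝ) + 1) * ε) * (36 * d * (frameC d L + d) ^ 2)
        * (1 + 2 * (Fintype.card n : ℝ) * (64 * (d : ℝ) ^ 2 * N) ^ d + 27 * (Fintype.card n : ℝ) ^ 3 * (512 : ℝ) ^ d * (N : ℝ) ^ d) / (1 - cruxC d L * ε) ≤ K₀s := by
    rw [← hcR, hK₀s]
    have hA : 0 ≤ (d : ℝ) * liftC d * (36 * d * (frameC d L + d) ^ 2) * cR := by have := liftC_nonneg d; positivity
    have key := supFacts_const_le d L hA hε.le hε1 hcε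
    calc (d : ℝ) * liftC d * (6 + 2 * ((d : ℝ) + 1) * ε) * (36 * d * (frameC d L + d) ^ 2) * cR / (1 - cruxC d L * ε)
        = (d : ℝ) * liftC d * (36 * d * (frameC d L + d) ^ 2) * cR * (6 + 2 * ((d : ℝ) + 1) * ε) / (1 - cruxC d L * ε) := by ring
      _ ≤ 2 * ((d : ℝ) * liftC d * (36 * d * (frameC d L + d) ^ 2) * cR * (6 + 2 * ((d : ℝ) + 1))) := key
  have hle₁ : (d : ℝ) * liftC d * (6 + 2 * ((d : ℝ) + 1) * ε) * (36 * d * (frameC d L + d))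
        * (1 + 2 * (Fintype.card n : ℝ) * (64 * (d : ℝ) ^ 2 * N) ^ d + 27 * (Fintype.card n : ℝ) ^ 3 * (512 : ℝ) ^ d * (N : ℝ) ^ d) / (1 - cruxC d L * ε) ≤ K₁s := by
    rw [← hcR, hK₁s]
    have hA : 0 ≤ (d : ℝ) * liftC d * (36 * d * (frameC d L + d)) * cR := by have := liftC_nonneg d; positivity
    have key := supFacts_const_le d L hA hε.le hε1 hcε
    calc (d : ℝ) * liftC d * (6 + 2 * ((d : ℝ) + 1) * ε) * (36 * d * (frameC d L + d)) * cR / (1 - cruxC d L * ε)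
        = (d : ℝ) * liftC d * (36 * d * (frameC d L + d)) * cR * (6 + 2 * ((d : ℝ) + 1) * ε) / (1 - cruxC d L * ε) := by ring
      _ ≤ 2 * ((d : ℝ) * liftC d * (36 * d * (frameC d L + d)) * cR * (6 + 2 * ((d : ℝ) + 1))) := key
  exact hr hg hε hεr' hs₁ hs₁r' hb hbh s₂ β hB8 (hF5_of_leafH3sup hd1 hL h3 hb' hc' hRb hεF hcF hle₀ hle₁) hP

/-! ## §3 (P♮) proved under the owner's four k-free lines (their slice constant is positive), at exponent `β` -/

/-- **THE END AT EXPONENT `β` WITH THE SLICE-POINCARÉ BINDER GONE, `∃ C ≥ 0` RIGHT AFTER `∀ g`** — `N16.ne3EnergyRateWCov_sfClass_small_of_lines_const` with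
`1 ↦ β` (same proof; the owner's slice constant `CP = 4·card n·(69 + 2δ_W)·CPLine` is POSITIVE, `CPLine_pos`) over §2 (`3 ≤ d`, `2 ≤ L`, `1 ≤ N`; the four k-free
lines on `(θ, εc) > 0`); `β` quantified after `∃ C`: ONE `(r, C)` for every exponent. [folklore] -/
theorem covRootHolderMS_sfClass_small_of_lines_const [Nonempty n] (hd : 3 ≤ d) {L N : ℕ} [NeZero L] [NeZero N] (hL : 2 ≤ L) (hN : 1 ≤ N)
    {θ εc : ℝ} (hθ : 0 < θ) (hεc : 0 < εc)
    (h1 : ShLine d L (Fintype.card n) εc θ ≤ 1 / 2) (h2 : SmallYLine d L (Fintype.card n) εc θ ≤ 1 / 2)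
    (h3 : 68 / 3 * (((d : ℝ) + 1) * ((d : ℝ) + 4)) * C2sq d L * θ ≤ rho d L / 2)
    (h4 : 8 * d * (((d : ℝ) - 1) * θ) ^ 2
      + 2 * ((Fintype.card n : ℝ) * ((4 * (d : ℝ) ^ 2 + 272 * d * (((d : ℝ) + 1) * ((d : ℝ) + 4))) * θ) ^ 2) ≤ 1 / 2) :
    ∃ r : ℝ, 0 < r ∧ ∀ ⦃g : ℝ⦄, 0 < g → ∃ C : ℝ, 0 ≤ C ∧ ∀ ⦃b' c' : ℝ⦄, 0 ≤ b' → 0 ≤ c' →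
      2 ^ 15 * ((d : ℝ) + 1) ^ 2 * ((d : ℝ) + 4) ^ 2 * (L : ℝ) ^ 2 * b' ≤ 1 →
      23040 * (d : ℝ) ^ 4 * (frameC d L + d) ^ 3 * (c' + curConst d L * b' ^ 2) ≤ 1 →
      ∀ ⦃ε s₁ b : ℝ⦄, 0 < ε → ε ≤ r → 0 ≤ s₁ → s₁ ≤ r → 0 ≤ b → b ≤ ε / 2 →
      ∀ (s₂ β : ℝ) {dom : _root_.Set (Site d → Fin d → (Matrix n n ℂ)ˣ)},
        PairLandauGaugeB8AvgMS d (sfClass d L N ε) L N b g s₁ s₂ β dom →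
        LeafH3sup d L N ε b' c' dom →
        CovRootHolderMS d (sfClass d L N ε) L N b g C s₁ s₂ β dom := by
  have hd1 : 1 ≤ d := by omega
  have hd0 : (0 : ℝ) < d := by exact_mod_cast (show 0 < d by omega)
  have hd1r : (1 : ℝ) ≤ d := by exact_mod_cast hd1
  have hdm : (0 : ℝ) ≤ (d : ℝ) - 1 := by linarith
  have hcard : (0 : ℝ) < (Fintype.card n : ℝ) := by exact_mod_cast Fintype.card_pos
  -- the k-free slice constant (verbatim `…N16ConstantOfRecord` §4), with its sign `CP > 0`
  obtain ⟨δW, hδW⟩ : ∃ D : ℝ, D = (2 + 32 * (8 * (Fintype.card n : ℝ) * d * (1 + 2 * (((d : ℝ) - 1) * θ)) ^ 2 * (2 * (8 : ℝ) ^ d) ^ 2))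
      * (8 * (Fintype.card n : ℝ) * d * (1 + 2 * (((d : ℝ) - 1) * θ)) ^ 2 * (2 * (8 : ℝ) ^ d) ^ 2) := ⟨_, rfl⟩
  have hδW0 : 0 ≤ δW := by
    rw [hδW]
    have : 0 ≤ 1 + 2 * (((d : ℝ) - 1) * θ) := by have := mul_nonneg hdm hθ.le; linarith
    positivity
  have hCPL : 0 < CPLine d L (Fintype.card n) εc θ := CPLine_pos hd1 L hcard hεc.le hθ.le
  obtain ⟨CP, hCP⟩ : ∃ C : ℝ, C = 4 * (Fintype.card n : ℝ) * (69 + 2 * δW) * CPLine d L (Fintype.card n) εc θ := ⟨_, rfl⟩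
  have hCP0 : 0 < CP := by rw [hCP]; positivity
  obtain ⟨r, hr0, hr⟩ := covRootHolderMS_sfClass_small_of_leafH3sup_const (n := n) hd hL hN hCP0
  -- the ε-radii of the lines absorbed into `r`
  obtain ⟨A, hA⟩ : ∃ A : ℝ, A = 128 * (69 + 2 * δW) * CPLine d L (Fintype.card n) εc θ * (Fintype.card (Plane d) : ℝ) * (Fintype.card n : ℝ) := ⟨_, rfl⟩
  have hA0 : 0 ≤ A := by rw [hA]; positivity
  obtain ⟨B₁, hB₁⟩ : ∃ B : ℝ, B = 16 * (14464 * ((d : ℝ) + 1) ^ 2 * ((d : ℝ) + 4) ^ 2) := ⟨_, rfl⟩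
  have hB₁0 : 0 < B₁ := by rw [hB₁]; positivity
  obtain ⟨B₂, hB₂⟩ : ∃ B : ℝ, B = 2 * twoLevelSmall d L := ⟨_, rfl⟩
  have hB₂0 : 0 < B₂ := by rw [hB₂]; unfold twoLevelSmall; positivity
  obtain ⟨B₃, hB₃⟩ : ∃ B : ℝ, B = 512 * ((d : ℝ) + 1) * ((d : ℝ) + 4) * (L : ℝ) ^ 2 := ⟨_, rfl⟩
  have hB₃0 : 0 < B₃ := by rw [hB₃]; positivity
  obtain ⟨B₄, hB₄⟩ : ∃ B : ℝ, B = 226 * (8 * ((d : ℝ) + 1) * ((d : ℝ) + 4)) ^ 2 := ⟨_, rfl⟩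
  have hB₄0 : 0 < B₄ := by rw [hB₄]; positivity
  refine ⟨min r (min θ (min (1 / (A + 1)) (min (3 / B₁) (min ((L : ℝ) ^ 2 / B₂) (min (1 / B₃) (2 / B₄)))))),
    lt_min hr0 (lt_min hθ (lt_min (by positivity) (lt_min (by positivity) (lt_min (by positivity) (lt_min (by positivity) (by positivity)))))),
    fun g hg => ?_⟩
  refine ⟨((1 + ((1 + 2048 * Real.sqrt (16 * d + 1)) + 23 * Real.sqrt 2 * Real.sqrt (16 * d + 1) * (1 + (1 + 2048 * Real.sqrt (16 * d + 1)))))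
          * (8 * (Fintype.card n : ℝ) * (1 + 4 * CP) * (8 + 1 / (2 * CP)))
          * ((1 + Real.sqrt (192 * ((d : ℝ) * L) * (d + Fintype.card (T4AveragingDeficitWall.Plane d))))
            * (Real.sqrt ((L : ℝ) ^ (d - 2))
              + (Real.sqrt ((L : ℝ) ^ (d - 2)) * Real.sqrt (8 * Fintype.card (T4AveragingDeficitWall.Plane d)) * (128 * (d * (L : ℝ) ^ 2))
                  + 2 * (2048 * ((d : ℝ) + 4) ^ 2 * (L : ℝ) ^ 2 * Real.sqrt (d * (L : ℝ) ^ d))) / 2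
              + (2 * (L : ℝ) ^ (d - 1) + 2 * (8 * d * (L : ℝ) ^ d)) * Real.sqrt (d / (g * (L : ℝ) ^ (d + 2))) / 4))),
    ?_, fun b' c' hb' hc' hRb hcF ε s₁ b hε hεr hs₁ hs₁r hb hbh s₂ β dom hB8 h3L => ?_⟩
  · have := hCP0.le; positivity
  have hεr' : ε ≤ r := hεr.trans (min_le_left _ _)
  have hεθ : ε ≤ θ := hεr.trans ((min_le_right _ _).trans (min_le_left _ _))
  have hεA : ε ≤ 1 / (A + 1) := hεr.trans ((min_le_right _ _).trans ((min_le_right _ _).trans (min_le_left _ _)))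
  have hε1 : ε ≤ 3 / B₁ := hεr.trans ((min_le_right _ _).trans ((min_le_right _ _).trans ((min_le_right _ _).trans (min_le_left _ _))))
  have hε2 : ε ≤ (L : ℝ) ^ 2 / B₂ :=
    hεr.trans ((min_le_right _ _).trans ((min_le_right _ _).trans ((min_le_right _ _).trans ((min_le_right _ _).trans (min_le_left _ _)))))
  have hε3 : ε ≤ 1 / B₃ :=
    hεr.trans ((min_le_right _ _).trans ((min_le_right _ _).trans ((min_le_right _ _).trans ((min_le_right _ _).trans ((min_le_right _ _).trans (min_le_left _ _))))))
  have hε4 : ε ≤ 2 / B₄ :=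
    hεr.trans ((min_le_right _ _).trans ((min_le_right _ _).trans ((min_le_right _ _).trans ((min_le_right _ _).trans ((min_le_right _ _).trans (min_le_right _ _))))))
  have hs₁r' : s₁ ≤ r := hs₁r.trans (min_le_left _ _)
  -- the lines at this `ε`
  have hf1 : 16 * (14464 * ((d : ℝ) + 1) ^ 2 * ((d : ℝ) + 4) ^ 2) * ε ≤ 3 := by
    rw [← hB₁]; rw [le_div_iff₀ hB₁0] at hε1; linarith
  have hf2 : 2 * twoLevelSmall d L * ε ≤ (L : ℝ) ^ 2 := by
    rw [← hB₂]; rw [le_div_iff₀ hB₂0] at hε2; linarith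
  have hbs : 512 * (d + 1) * (d + 4) * (L : ℝ) ^ 2 * b ≤ 1 := by
    have h1' : B₃ * ε ≤ 1 := by rw [le_div_iff₀ hB₃0] at hε3; linarith
    have : B₃ * b ≤ B₃ * ε := mul_le_mul_of_nonneg_left (by linarith) hB₃0.le
    rw [hB₃] at this h1'
    linarith
  have hbε' : b + 226 * (8 * (d + 1) * (d + 4)) ^ 2 * b ^ 2 ≤ ε := by
    have hB4ε : B₄ * ε ≤ 2 := by rw [le_div_iff₀ hB₄0] at hε4; linarith
    have hb2 : b ^ 2 ≤ (ε / 2) ^ 2 := pow_le_pow_left₀ hb hbh 2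
    have : B₄ * b ^ 2 ≤ ε / 2 := by
      calc B₄ * b ^ 2 ≤ B₄ * (ε / 2) ^ 2 := mul_le_mul_of_nonneg_left hb2 hB₄0.le
        _ = (B₄ * ε) * ε / 4 := by ring
        _ ≤ 2 * ε / 4 := by
            have := mul_le_mul_of_nonneg_right hB4ε hε.le
            linarith
        _ = ε / 2 := by ring
    rw [hB₄] at this
    linarith
  have h6 : 128 * (69 + 2 * ((2 + 32 * (8 * (Fintype.card n : ℝ) * d * (1 + 2 * (((d : ℝ) - 1) * θ)) ^ 2 * (2 * (8 : ℝ) ^ d) ^ 2))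
              * (8 * (Fintype.card n : ℝ) * d * (1 + 2 * (((d : ℝ) - 1) * θ)) ^ 2 * (2 * (8 : ℝ) ^ d) ^ 2)))
        * CPLine d L (Fintype.card n) εc θ * (Fintype.card (Plane d) : ℝ) * (Fintype.card n : ℝ) * ε ^ 2 ≤ 1 := by
    rw [← hδW, ← hA]
    have hA1 : 0 < A + 1 := by linarith
    have hεA' : ε * (A + 1) ≤ 1 := by rwa [le_div_iff₀ hA1] at hεA
    have hε1' : ε ≤ 1 := by
      have : ε ≤ ε * (A + 1) := le_mul_of_one_le_right hε.le (by linarith)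
      linarith
    have t1 : A * ε * ε ≤ A * ε * 1 := mul_le_mul_of_nonneg_left hε1' (by positivity)
    have t2 : A * ε ≤ ε * (A + 1) := by linarith [hε.le]
    calc A * ε ^ 2 = A * ε * ε := by ring
      _ ≤ A * ε * 1 := t1
      _ = A * ε := by ring
      _ ≤ ε * (A + 1) := t2
      _ ≤ 1 := hεA'
  refine hr hg hb' hc' hRb hcF hε hεr' hs₁ hs₁r' hb hbh s₂ β hB8 h3L ?_
  intro j V _ UB _ hreg
  have hP := slicePoincare_slicB8_cavg_of_regular hd hL hN hb hε hεθ hεc hbs hbε' hf1 hf2 h1 h2 h3 h4 h6 j hreg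
  rw [← hδW, ← hCP] at hP
  exact hP

/-! ## §4 The `d = 4` instance: N16's CONSTANT OF RECORD at exponent `β` -/

/-- **N16 · THE CONSTANT OF RECORD AT HÖLDER EXPONENT `β`** (`d = 4`; `L ≥ 2`, `N ≥ 1`) — `N16.n16_constant_of_record` with `1 ↦ β`: there is `r > 0` depending on
`(L, N, n)` ONLY such that for every regularity letter `g > 0` there is ONE constant `C ≥ 0` depending on `(L, N, n, g)` ONLY such that for all leaf letters `0 ≤ b′, c′`
on (Rb) and the `c′`-line, every class radius `0 < ε ≤ r`, B8 constant `0 ≤ s₁ ≤ r`, regularity `0 ≤ b ≤ ε∕2`, every `s₂`, EVERY EXPONENT `β` and every `dom`: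
`PairLandauGaugeB8Avg 4 (sfClass 4 L N ε) L N b g s₁ s₂ β dom` (N05: [Balaban1985RegularSpaces] Thm 2 + (1.37) at the pair, Hölder member at exponent `β` — printed
for `β ≤ β₀ < 1`) and `LeafH3sup 4 L N ε b′ c′ dom` (N07) imply `CovRootHolderMS 4 (sfClass 4 L N ε) L N b g C s₁ s₂ β dom` (= `N16HolderAt`'s body).  At `β := 1`
this is `n16_constant_of_record` (`covRootHolder_one_iff`).  N16 ∕ NE3 NOT proved: the two interfaces are the hypotheses. [folklore] -/
theorem n16_holderMS_constant_of_record [Nonempty n] {L N : ℕ} (hL : 2 ≤ L) (hN : 1 ≤ N) :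
    ∃ r : ℝ, 0 < r ∧ ∀ ⦃g : ℝ⦄, 0 < g → ∃ C : ℝ, 0 ≤ C ∧ ∀ ⦃b' c' : ℝ⦄, 0 ≤ b' → 0 ≤ c' →
      2 ^ 15 * ((4 : ℝ) + 1) ^ 2 * ((4 : ℝ) + 4) ^ 2 * (L : ℝ) ^ 2 * b' ≤ 1 →
      23040 * (4 : ℝ) ^ 4 * (frameC 4 L + 4) ^ 3 * (c' + curConst 4 L * b' ^ 2) ≤ 1 →
      ∀ ⦃ε s₁ b : ℝ⦄, 0 < ε → ε ≤ r → 0 ≤ s₁ → s₁ ≤ r → 0 ≤ b → b ≤ ε / 2 →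
      ∀ (s₂ β : ℝ) {dom : _root_.Set (Site 4 → Fin 4 → (Matrix n n ℂ)ˣ)},
        PairLandauGaugeB8AvgMS 4 (sfClass 4 L N ε) L N b g s₁ s₂ β dom →
        LeafH3sup 4 L N ε b' c' dom →
        CovRootHolderMS 4 (sfClass 4 L N ε) L N b g C s₁ s₂ β dom := by
  haveI : NeZero L := NeZero.of_pos (by omega); haveI : NeZero N := NeZero.of_pos (by omega)
  obtain ⟨θ, εc, hθ, hεc, h1, h2, h3, h4⟩ := ownerLines_exist 4 (L := L) (by omega) (c := (Fintype.card n : ℝ)) (by positivity)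
  obtain ⟨r, hr0, hr⟩ := covRootHolderMS_sfClass_small_of_lines_const (d := 4) (n := n) (by norm_num) hL hN hθ hεc h1 h2 h3 h4
  refine ⟨r, hr0, fun g hg => ?_⟩
  obtain ⟨C, hC0, hC⟩ := hr hg
  refine ⟨C, hC0, fun b' c' hb' hc' hRb hcF => ?_⟩
  exact hC hb' hc' (by simpa only [Nat.cast_ofNat] using hRb) (by simpa only [Nat.cast_ofNat] using hcF)

/-- **… AND BACK TO THE RECORD AT `β = 1`**: §4 at exponent `1` returns `N16.n16_constant_of_record`'s conclusion (`covRootHolder_one_iff`). [folklore] -/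
theorem ne3EnergyRateWCov_of_holderMS_constant_one [Nonempty n] {L N : ℕ} (hL : 2 ≤ L) (hN : 1 ≤ N) :
    ∃ r : ℝ, 0 < r ∧ ∀ ⦃g : ℝ⦄, 0 < g → ∃ C : ℝ, 0 ≤ C ∧ ∀ ⦃b' c' : ℝ⦄, 0 ≤ b' → 0 ≤ c' →
      2 ^ 15 * ((4 : ℝ) + 1) ^ 2 * ((4 : ℝ) + 4) ^ 2 * (L : ℝ) ^ 2 * b' ≤ 1 →
      23040 * (4 : ℝ) ^ 4 * (frameC 4 L + 4) ^ 3 * (c' + curConst 4 L * b' ^ 2) ≤ 1 →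
      ∀ ⦃ε s₁ b : ℝ⦄, 0 < ε → ε ≤ r → 0 ≤ s₁ → s₁ ≤ r → 0 ≤ b → b ≤ ε / 2 →
      ∀ (s₂ : ℝ) {dom : _root_.Set (Site 4 → Fin 4 → (Matrix n n ℂ)ˣ)},
        PairLandauGaugeB8AvgMS 4 (sfClass 4 L N ε) L N b g s₁ s₂ 1 dom →
        LeafH3sup 4 L N ε b' c' dom →
        NE3EnergyWeightedCovShape.NE3EnergyRateWCov 4 (sfClass 4 L N ε) L N b g C s₁ s₂ dom := by
  obtain ⟨r, hr0, hr⟩ := n16_holderMS_constant_of_record (n := n) hL hN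
  refine ⟨r, hr0, fun g hg => ?_⟩
  obtain ⟨C, hC0, hC⟩ := hr hg
  refine ⟨C, hC0, fun b' c' hb' hc' hRb hcF ε s₁ b hε hεr hs₁ hs₁r hb hbh s₂ dom hB8 h3 => ?_⟩
  exact N16HolderMSDefs.ne3EnergyRateWCov_of_covRootHolderMS_one (by omega) (hC hb' hc' hRb hcF hε hεr hs₁ hs₁r hb hbh s₂ 1 hB8 h3)

end

end Summit.QuantumFields.YangMills.BalabanUVNodes.N16HolderMSConst
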